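import Summits.QuantumAdvantage.QuantumAdvantage.Theorems.CubicForrelationNearExactIsExactBentFourteenFiftySevenSixtyFourths
import Summits.QuantumAdvantage.QuantumAdvantage.Theorems.CubicForrelationNearExactIsExactBentEighteenThirtyOneThirtySeconds
import Summits.QuantumAdvantage.QuantumAdvantage.Theorems.CubicForrelationNearExactIsExactBentTwentyTwoSixtyThreeSixtyFourths
import Summits.QuantumAdvantage.QuantumAdvantage.Theorems.CubicForrelationNearExactIsExactBentMinWeightAllN

/-!
# Crux `CubicForrelation.NearExactIsExact` (stmt-QuantumAdvantage-14043) — the BENT SIDE of the `θ_n` ladder, index (2026-08-26, gen 45)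

Certificate seat `b2b-cforr-cert` (gen 45).  HONEST FRAMING: this file adds NO new mathematics; it states in ONE place exactly what the tree
proves about cubic pairs `(f, g)` with a BENT side `g`, at which `n` (all kernel-checked, standard axioms, certificate-free).  NOT summit
progress: the windows of the `θ_n` ladder (…LadderSummaryC) are unchanged — inside every open window both sides are non-bent as far as the
rows below reach, and nothing here bounds the crux's uniform `θ`.

| `n` | bent side `g` ⇒ | deciding declarations |
|-----|-----------------|------------------------|
| `14` | `Φ = 1 ∨ Φ ≤ 57/64` (the record of the slice; window `[57/64, 61/64)`) | `fo_bent_le_57_64` (gens 9, 44, 45: `fo_bent_false`, `fo_bent_ne_29_32`, `kt_gap_rm5_fourteen`) |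
| `18` | `Φ = 1 ∨ Φ ≤ 121/128` (window `[15/16, 63/64)`: `31/32`, `61/64` excluded) | `fo18_bent_le_121_128` (`fo18_bent_ne_31_32`, `fo18_bent_ne_61_64`, `kt_gap_order`) |
| `22` | `Φ = 1 ∨ Φ ≤ 249/256` (window `[15/16, 127/128)`: `63/64`, `125/128` excluded) | `fo22_bent_le_249_256` |
| `4b + 14` (all `b`) | `Φ = 1 ∨ Φ = 1 − 3/2^{b+5} ∨ Φ ≤ 1 − 7/2^{b+6}` (minimum-weight line dead) | `fo_bent_values_two_mod_four`, `fo_bent_minweight_ne` |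
| `2m ≥ 6` (all `m`) | `Φ ∈ {1, 1 − 2/2^{r₀}, 1 − 3/2^{r₀}} ∪ (−∞, 1 − 7/2^{r₀+1}]`, `r₀ = ⌊(m+3)/2⌋` | `fo_bent_values_all` (Hou + second weight + `kt_gap_order`) |

On paper (DISPROOF.md §18, THEOREM BENT, machine certificates): `n = 14`: `Φ = 1 ∨ Φ ≤ 7/8`; `n = 18, 20`: `≤ 15/16`; `n = 22, 24`: `≤ 31/32` —
NOT claimed here.  Instances `n = 26, 30` of the uniform row are spelled out below (`127/128`, `255/256` dead on the bent side).
-/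

set_option linter.dupNamespace false -- D-0017: single-problem summit ⇒ `QuantumAdvantage.QuantumAdvantage` by design

noncomputable section

namespace Summit.QuantumAdvantage.QuantumAdvantage.Theorems.CubicForrelation.NearExactIsExact

open Finset
open Literature.Computability.QuantumComplexity
open Literature.Computability.QuantumComplexity.DerivativeWalsh (W)

/-- **`n = 26`: a cubic bent function has no cubic partner at `Φ = 127/128`** (a value inside the open window `θ₂₆ ∈ [15/16, 511/512)`);
instance `b = 3` of `fo_bent_minweight_ne`.  NOT summit progress. [this work] -/
theorem fo26_bent_ne_127_128 (f g : (Fin (13 + 13) → Bool) → Bool) (hf : IsDegLeFun 3 f) (hg : IsDegLeFun 3 g)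
    (hbent : ∀ x, W (fun y => signOf (g y)) x ^ 2 = (2 : ℝ) ^ (13 + 13)) : forrelation f g ≠ 127 / 128 := by
  have h := fo_bent_minweight_ne 3 f g hf hg hbent
  norm_num at h ⊢
  exact h

/-- **`n = 30`: a cubic bent function has no cubic partner at `Φ = 255/256`** (inside the open window `θ₃₀ ∈ [15/16, 1023/1024)`);
instance `b = 4` of `fo_bent_minweight_ne`.  NOT summit progress. [this work] -/
theorem fo30_bent_ne_255_256 (f g : (Fin (15 + 15) → Bool) → Bool) (hf : IsDegLeFun 3 f) (hg : IsDegLeFun 3 g)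
    (hbent : ∀ x, W (fun y => signOf (g y)) x ^ 2 = (2 : ℝ) ^ (15 + 15)) : forrelation f g ≠ 255 / 256 := by
  have h := fo_bent_minweight_ne 4 f g hf hg hbent
  norm_num at h ⊢
  exact h

/-- **The bent side of the ladder (2026-08-26).**  Conjunction of the rows `n = 14, 18, 22` of the table in the module docstring: a cubic pair
with a bent side has `Φ = 1 ∨ Φ ≤ 57/64` (14 bits), `Φ = 1 ∨ Φ ≤ 121/128` (18 bits), `Φ = 1 ∨ Φ ≤ 249/256` (22 bits); and for every
`n = 4b + 14` the minimum-weight line `1 − 2/2^{b+5}` is not a bent-side value.  NOT summit progress. [this work] -/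
theorem bent_side_ladder :
    (∀ f g : (Fin (7 + 7) → Bool) → Bool, IsDegLeFun 3 f → IsDegLeFun 3 g →
      (∀ x, W (fun y => signOf (g y)) x ^ 2 = (2 : ℝ) ^ (7 + 7)) → forrelation f g = 1 ∨ forrelation f g ≤ 57 / 64) ∧
    (∀ f g : (Fin (9 + 9) → Bool) → Bool, IsDegLeFun 3 f → IsDegLeFun 3 g →
      (∀ x, W (fun y => signOf (g y)) x ^ 2 = (2 : ℝ) ^ (9 + 9)) → forrelation f g = 1 ∨ forrelation f g ≤ 121 / 128) ∧
    (∀ f g : (Fin (11 + 11) → Bool) → Bool, IsDegLeFun 3 f → IsDegLeFun 3 g →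
      (∀ x, W (fun y => signOf (g y)) x ^ 2 = (2 : ℝ) ^ (11 + 11)) → forrelation f g = 1 ∨ forrelation f g ≤ 249 / 256) ∧
    (∀ (b : ℕ) (f g : (Fin ((2 * b + 7) + (2 * b + 7)) → Bool) → Bool), IsDegLeFun 3 f → IsDegLeFun 3 g →
      (∀ x, W (fun y => signOf (g y)) x ^ 2 = (2 : ℝ) ^ ((2 * b + 7) + (2 * b + 7))) → forrelation f g ≠ 1 - 2 / 2 ^ (b + 5)) :=
  ⟨fo_bent_le_57_64, fo18_bent_le_121_128, fo22_bent_le_249_256, fo_bent_minweight_ne⟩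

end Summit.QuantumAdvantage.QuantumAdvantage.Theorems.CubicForrelation.NearExactIsExact

end
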